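import Mathlib.Algebra.MvPolynomial.Monad
import Literature.Computability.AlgebraicComplexity.ValiantClassesProofs
import HarnessLib

/-!
# `VNP` is closed under p-projections: discharge of `IsVNPFamily.of_isPProjection`

D-0014 keeps `Literature/` sorry-free by stating cited results as named facts `def X : Prop`.
This sibling file of `Literature.Computability.AlgebraicComplexity.ValiantClasses` proves, from
the definitions and the already discharged closure of `VP` (`IsVPFamily.of_isPProjection_holds`,
`ValiantClassesProofs.lean`), that Valiant's class `VNP` is closed under p-projections among
p-families (Bürgisser 2000, §2.1; Bürgisser–Clausen–Shokrollahi 1997, Rem. (21.13)(2), p. 548: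
"The classes **VP** and **VNP** are closed under p-projections"):

* `IsVNPFamily.of_isPProjection_holds` — **the named fact holds**.

## The printed proof and the one formalised

Both sources record the closure without proof. The argument is the evident one: project the
`VP` witness family. If `f n = Σ_{e ∈ {0,1}^{u n}} G n (X, e)` with `G ∈ VP` (the definition of
`IsVNPFamily`) and `g n = (f (t n))(a_n)` with `t` p-bounded and each `a_n i` a variable or a
constant, then `g n = Σ_e G' n (X, e)` with
`G' n := (G (t n))(inl i ↦ rename inl (a_n i), inr j ↦ X (inr j))`,
a p-projection of `G` (along the same `t`), which is a p-family (its number of variables is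
`#τ n + u (t n)`, its degree at most that of `G (t n)` because a projection does not raise the
total degree) and hence lies in `VP` by `IsVPFamily.of_isPProjection_holds`; the Boolean sum
commutes with the substitution because the substitution fixes the Boolean variables.

The degree bound for projections is the content of the named fact `IsProjection.totalDegree_le`
of `ValiantClasses.lean`, discharged in the tree as `DefVNP.IsProjection.totalDegree_le_holds`
(`DefinableVNPWitness.lean`); it is re-proved here as a private lemma (a dozen lines) so that this
basic closure property does not import the real-τ-conjecture development that module carries.

## References

* [Burgisser2000] P. Bürgisser, *Completeness and Reduction in Algebraic Complexity Theory*,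
  Springer (2000), §2.1 (p-projections; closure of `VP`, `VNP`), Def. 2.8–2.9 (`VNP`).
* [BurgisserClausenShokrollahi1997] P. Bürgisser, M. Clausen, M. A. Shokrollahi, *Algebraic
  Complexity Theory*, Springer (1997), Def. (21.12)(2) p. 547, Rem. (21.13)(2) p. 548.
-/

open MvPolynomial

namespace Literature.Computability.AlgebraicComplexity

universe u v w

section Degree

variable {R : Type*} [CommSemiring R]

/-- A substitution by polynomials of degree `≤ 1` does not increase the total degree (twin of
`DefVNP.totalDegree_bind₁_le`, kept private to keep the imports light). [folklore] -/
private theorem totalDegree_bind₁_le_of_le_one {σ τ : Type*} {h : σ → MvPolynomial τ R}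
    (hh : ∀ v, (h v).totalDegree ≤ 1) (p : MvPolynomial σ R) :
    (bind₁ h p).totalDegree ≤ p.totalDegree := by
  classical
  conv_lhs => rw [p.as_sum, map_sum]
  refine (totalDegree_finsetSum _ _).trans (Finset.sup_le fun m hm => ?_)
  rw [bind₁_monomial]
  refine (totalDegree_mul _ _).trans ?_
  rw [totalDegree_C, zero_add]
  change (∏ v ∈ m.support, h v ^ m v).totalDegree ≤ _
  refine (totalDegree_finsetProd _ _).trans ?_
  calc ∑ v ∈ m.support, (h v ^ m v).totalDegree ≤ ∑ v ∈ m.support, m v :=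
        Finset.sum_le_sum fun v _ => (totalDegree_pow _ _).trans (by have := hh v; nlinarith)
    _ = m.sum fun _ e => e := rfl
    _ ≤ p.totalDegree := le_totalDegree hm

/-- A projection does not increase the total degree (Bürgisser 2000, §2.1; twin of the tree's
discharge `DefVNP.IsProjection.totalDegree_le_holds` of the named fact
`IsProjection.totalDegree_le`). [cite: Burgisser2000, §2.1] -/
private theorem totalDegree_le_of_isProjection {σ τ : Type*} {g : MvPolynomial τ R}
    {f : MvPolynomial σ R} (h : IsProjection g f) : g.totalDegree ≤ f.totalDegree := by
  obtain ⟨a, ha, rfl⟩ := h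
  rw [aeval_eq_bind₁]
  refine totalDegree_bind₁_le_of_le_one (fun v => ?_) f
  rcases ha v with ⟨j, hj⟩ | ⟨c, hc⟩
  · rw [hj, X]
    exact (totalDegree_monomial_le _ _).trans (by simp)
  · rw [hc, totalDegree_C]; exact Nat.zero_le _

end Degree

section Families

variable {k : Type u} [CommSemiring k] {σ : ℕ → Type v} {τ : ℕ → Type w}
  [∀ n, Fintype (σ n)] [∀ n, Fintype (τ n)]

/-- **Discharge of `IsVNPFamily.of_isPProjection`** (`VNP` is closed under p-projections among
p-families): if `g` is a p-family and a p-projection of `f ∈ VNP`, then `g ∈ VNP` — project the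
`VP` witness family `G` of `f` along the same `t`, substituting `rename inl (a_n i)` for the
genuine variables and leaving the Boolean variables alone; the projected family is in `VP` by
`IsVPFamily.of_isPProjection_holds` and its Boolean sum is `g n`
(Bürgisser 2000, §2.1; Bürgisser–Clausen–Shokrollahi 1997, Rem. (21.13)(2), p. 548: "The classes
VP and VNP are closed under p-projections", where by Def. (21.12)(2) `≤_p` relates p-families).
[cite: Burgisser2000, §2.1] [cite: BurgisserClausenShokrollahi1997, Rem. (21.13)(2), p. 548] -/
theorem IsVNPFamily.of_isPProjection_holds :
    IsVNPFamily.of_isPProjection (k := k) (σ := σ) (τ := τ) := by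
  intro g f hg hgf hf
  obtain ⟨t, ht, hproj⟩ := hgf
  obtain ⟨_, u, G, hG, hfG⟩ := hf
  choose a ha hga using hproj
  -- the projected witness family, in the variables `τ n ⊕ Fin (u (t n))`
  let s : ∀ n, σ (t n) ⊕ Fin (u (t n)) → MvPolynomial (τ n ⊕ Fin (u (t n))) k :=
    fun n => Sum.elim (fun i => rename Sum.inl (a n i)) (fun j => X (Sum.inr j))
  have hs : ∀ n, IsProjection (aeval (s n) (G (t n))) (G (t n)) := by
    intro n
    refine ⟨s n, ?_, rfl⟩
    rintro (i | j)
    · rcases ha n i with ⟨j, hj⟩ | ⟨c, hc⟩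
      · exact Or.inl ⟨Sum.inl j, by simp [s, hj]⟩
      · exact Or.inr ⟨c, by simp [s, hc]⟩
    · exact Or.inl ⟨Sum.inr j, by simp [s]⟩
  refine ⟨hg, fun n => u (t n), fun n => aeval (s n) (G (t n)), ?_, ?_⟩
  · -- `G' ∈ VP`: a p-family (`#τ n + u (t n)` variables, degree `≤ deg G (t n)`) and a
    -- p-projection of `G`
    have hGP : IsPFamily G := hG.1
    have hu : IsPBounded fun n => u (t n) := by
      refine IsPBounded.comp_holds (s := u) (hGP.1.mono fun m => ?_) ht
      simp [Fintype.card_sum]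
    have hPF : IsPFamily (fun n => aeval (s n) (G (t n))) := by
      refine ⟨(IsPBounded.add_holds hg.1 hu).mono fun n => ?_,
        (IsPBounded.comp_holds hGP.2 ht).mono fun n => ?_⟩
      · simp [Fintype.card_sum]
      · exact totalDegree_le_of_isProjection (hs n)
    exact IsVPFamily.of_isPProjection_holds hPF ⟨t, ht, hs⟩ hG
  · -- `g n = boolSum (G' n)`: the substitution fixes the Boolean variables
    intro n
    rw [hga n, hfG (t n)]
    simp only [boolSum, map_sum]
    refine Finset.sum_congr rfl fun e _ => ?_
    rw [← AlgHom.comp_apply, ← AlgHom.comp_apply, MvPolynomial.comp_aeval, MvPolynomial.comp_aeval]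
    refine congrArg (fun φ : σ (t n) ⊕ Fin (u (t n)) → MvPolynomial (τ n) k => aeval φ (G (t n))) ?_
    funext x
    rcases x with i | j
    · have h1 : aeval (Sum.elim X fun j => if e j = true then (1 : MvPolynomial (τ n) k) else 0)
          (s n (Sum.inl i)) = a n i := by
        simp only [s, Sum.elim_inl, aeval_rename, Function.comp_def]
        exact aeval_X_left_apply (a n i)
      rw [h1]
      simp
    · simp only [Sum.elim_inr, aeval_X, s]
      split_ifs <;> simp

end Families

end Literature.Computability.AlgebraicComplexity
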